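import Mathlib
import Summits.CriticalPhenomena.Ising3DConformalLimit.Theses.HyperoctahedralRP
import Summits.CriticalPhenomena.Ising3DConformalLimit.Theorems.HyperoctahedralRPNullConeLocalRigidityDivide
import Summits.CriticalPhenomena.Ising3DConformalLimit.Theorems.HyperoctahedralRPNullConeLocalRigidityInvariants

/-!
# Null-cone local rigidity (route HyperoctahedralRP, item `stmt-CriticalPhenomena-4275`)

`nullConeLocalRigidity_proof :
  Summit.CriticalPhenomena.Ising3DConformalLimit.Theses.HyperoctahedralRP.NullConeLocalRigidity`.

**Statement.** Let `Q ∈ ℝ[x₀,x₁,x₂]` be homogeneous of degree `2m`, invariant under coordinate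
permutations and sign changes.  If for a real sequence `εₙ → 0`, `εₙ ≠ 0`, every complex root
`t` of `Pₙ(a + t, -a + t, b) = 0`, `Pₙ = (x·x)^m + εₙ Q`, `(a, b) ∈ ℝ² ∖ {0}`, is purely imaginary,
then `Q = c · (x·x)^m`.

**Proof** (induction on `m`; files `…NullConeLocalRigidity{Roots,Fibre,Divide,Invariants}`).
Rotate to `y = (x₀+x₁, x₀-x₁, x₂)`: the fibre is the `y₀`-axis through `(2a, b)` and
`2(x·x) = y₀² + y₁² + 2y₂²`.  The fibre polynomial of `Q` is even in `y₀`, so with `u = y₀² + c`,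
`c = 4a² + 2b²`, the root test says that `u^m + εₙ q(u)` has only real roots, where
`q(0) = 2^m Q(z)` at the complex null vector `z = (a + i τ, -a + i τ, b)`, `τ² = a² + b²/2`.
Vieta + Newton (`Σ uᵢ² = e₁² - 2e₂ = O(εₙ)`, `(∏ uᵢ)² ≤ (Σ uᵢ²)^m`) give `q(0) = 0` for `m ≥ 3`;
so `Q` vanishes on the null family, hence `x·x ∣ Q` (division by the monic quadratic
`Y² + y₁² + 2y₂²` and a real/imaginary-part argument), the cofactor inherits all hypotheses with
`m - 1`, and we recurse.  For `m = 2`, `Q = A Σxᵢ⁴ + B Σ xᵢ²xⱼ²` (invariant theory) and the root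
test gives the one-sided condition `εₙ Q(z) ≤ O(εₙ²)`; at the two null vectors
`(1+i, -1+i, 0)` and `(1+3i, -1+3i, 4)` the values are `w` and `-39 w` (`w = -8A + 4B`), forcing
`w = 0`, `B = 2A`, `Q = A (x·x)²`.  For `m = 1`, `Q = A (x·x)` by invariance alone; `m = 0` is
trivial.  Sources: the item's informal proof (cards hrp-null-cone-root-splitting,
hyperoctahedral-rp-rigidity); Nuij (1968), Kostov (1989) for the local geometry of hyperbolic
pencils (not used formally).
-/

noncomputable section

open MvPolynomial Filter Topology

namespace Summit.CriticalPhenomena.Ising3DConformalLimit.Theorems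

open NullConeLocalRigidity

/-! ### The rotated polynomial `2^m · Q((y₀+y₁)/2, (y₀-y₁)/2, y₂)` -/

/-- The rotation is linear, so it preserves homogeneity. -/
theorem NullConeLocalRigidity.rotated_isHomogeneous {Q : MvPolynomial (Fin 3) ℝ} {n : ℕ}
    (hQ : Q.IsHomogeneous n) (k : ℝ) :
    (MvPolynomial.C k * MvPolynomial.aeval
      ![MvPolynomial.C (1 / 2 : ℝ) * (X 0 + X 1), MvPolynomial.C (1 / 2 : ℝ) * (X 0 - X 1),
        (X 2 : MvPolynomial (Fin 3) ℝ)] Q).IsHomogeneous n := by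
  have h := hQ.aeval
    ![MvPolynomial.C (1 / 2 : ℝ) * (X 0 + X 1), MvPolynomial.C (1 / 2 : ℝ) * (X 0 - X 1),
      (X 2 : MvPolynomial (Fin 3) ℝ)] (n := 1) (by
      intro i
      fin_cases i
      · simpa using ((isHomogeneous_X ℝ 0).add (isHomogeneous_X ℝ 1)).C_mul (1 / 2 : ℝ)
      · simpa using ((isHomogeneous_X ℝ 0).sub (isHomogeneous_X ℝ 1)).C_mul (1 / 2 : ℝ)
      · simpa using isHomogeneous_X ℝ (2 : Fin 3))
  rw [one_mul] at h
  exact h.C_mul k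

/-- The rotated polynomial of an invariant `Q` is even in `y₀` (the reflection `y₀ ↦ -y₀` is
`(x₀, x₁) ↦ (-x₁, -x₀)`). -/
theorem NullConeLocalRigidity.rotated_even {Q : MvPolynomial (Fin 3) ℝ}
    (hsymm : ∀ σ : Equiv.Perm (Fin 3), rename σ Q = Q)
    (heven : ∀ i : Fin 3, MvPolynomial.aeval
      (fun j : Fin 3 => if j = i then -(X j : MvPolynomial (Fin 3) ℝ) else X j) Q = Q) (k : ℝ) :
    ∀ d : Fin 3 →₀ ℕ, Odd (d 0) → coeff d (MvPolynomial.C k * MvPolynomial.aeval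
      ![MvPolynomial.C (1 / 2 : ℝ) * (X 0 + X 1), MvPolynomial.C (1 / 2 : ℝ) * (X 0 - X 1),
        (X 2 : MvPolynomial (Fin 3) ℝ)] Q) = 0 := by
  apply coeff_eq_zero_of_odd 0
  set L : Fin 3 → MvPolynomial (Fin 3) ℝ :=
    ![MvPolynomial.C (1 / 2 : ℝ) * (X 0 + X 1), MvPolynomial.C (1 / 2 : ℝ) * (X 0 - X 1),
      (X 2 : MvPolynomial (Fin 3) ℝ)] with hL
  set S : Fin 3 → MvPolynomial (Fin 3) ℝ := ![-X 1, -X 0, X 2] with hS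
  rw [map_mul, MvPolynomial.aeval_C, algebraMap_eq, MvPolynomial.comp_aeval_apply]
  congr 1
  have h1 : (fun i => MvPolynomial.aeval
      (fun j : Fin 3 => if j = 0 then -(X j : MvPolynomial (Fin 3) ℝ) else X j) (L i))
      = fun i => MvPolynomial.aeval L (S i) := by
    funext i
    fin_cases i
    · simp [hL, hS]
      ring
    · simp [hL, hS]
      ring
    · simp [hL, hS]
  rw [h1, ← MvPolynomial.comp_aeval_apply (f := S) (MvPolynomial.aeval L) Q]
  congr 1
  have h2 : (MvPolynomial.aeval S : MvPolynomial (Fin 3) ℝ →ₐ[ℝ] MvPolynomial (Fin 3) ℝ)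
      = (rename (Equiv.swap 0 1)).comp ((MvPolynomial.aeval
          (fun j : Fin 3 => if j = 0 then -(X j : MvPolynomial (Fin 3) ℝ) else X j)).comp
        (MvPolynomial.aeval
          (fun j : Fin 3 => if j = 1 then -(X j : MvPolynomial (Fin 3) ℝ) else X j))) := by
    apply MvPolynomial.algHom_ext
    intro i
    fin_cases i <;> simp [hS, Equiv.swap_apply_def]
  rw [h2, AlgHom.comp_apply, AlgHom.comp_apply, heven 1, heven 0, hsymm]

/-- Evaluating the rotated polynomial on the fibre is evaluating `Q` at the rotated point
`p = ((y + v₀)/2, (y - v₀)/2, v₁)`. -/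
theorem NullConeLocalRigidity.aeval_cons_rotated (y : ℂ) (v : Fin 2 → ℝ) (k : ℝ)
    (Q : MvPolynomial (Fin 3) ℝ) (p : Fin 3 → ℂ) (hp0 : p 0 = (y + v 0) / 2)
    (hp1 : p 1 = (y - v 0) / 2) (hp2 : p 2 = v 1) :
    MvPolynomial.aeval (Fin.cons y (fun j => (v j : ℂ)) : Fin 3 → ℂ)
      (MvPolynomial.C k * MvPolynomial.aeval
        ![MvPolynomial.C (1 / 2 : ℝ) * (X 0 + X 1), MvPolynomial.C (1 / 2 : ℝ) * (X 0 - X 1),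
          (X 2 : MvPolynomial (Fin 3) ℝ)] Q)
      = (k : ℂ) * MvPolynomial.aeval p Q := by
  have h1 : (Fin.cons y (fun j => (v j : ℂ)) : Fin 3 → ℂ) 1 = v 0 := rfl
  have h2 : (Fin.cons y (fun j => (v j : ℂ)) : Fin 3 → ℂ) 2 = v 1 := rfl
  rw [map_mul, MvPolynomial.aeval_C, MvPolynomial.comp_aeval_apply]
  have hfun : (fun i => MvPolynomial.aeval (Fin.cons y (fun j => (v j : ℂ)) : Fin 3 → ℂ)
      (![MvPolynomial.C (1 / 2 : ℝ) * (X 0 + X 1), MvPolynomial.C (1 / 2 : ℝ) * (X 0 - X 1),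
        (X 2 : MvPolynomial (Fin 3) ℝ)] i)) = p := by
    funext i
    fin_cases i
    · simp [h1, hp0]
      ring
    · simp [h1, hp1]
      ring
    · simp [h2, hp2]
  rw [hfun]
  rfl

/-! ### The step `m ≥ 3`: `Q` vanishes on the null family, hence `x·x ∣ Q` -/

/-- For `m ≥ 3` the root test forces the rotated `Q` to vanish at every null vector of the
family. -/
theorem NullConeLocalRigidity.rotated_null_eq_zero {m : ℕ} (hm : 3 ≤ m)
    (Q : MvPolynomial (Fin 3) ℝ) (hhom : Q.IsHomogeneous (2 * m))
    (hsymm : ∀ σ : Equiv.Perm (Fin 3), rename σ Q = Q)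
    (heven : ∀ i : Fin 3, MvPolynomial.aeval
      (fun j : Fin 3 => if j = i then -(X j : MvPolynomial (Fin 3) ℝ) else X j) Q = Q)
    (ε : ℕ → ℝ) (hε : Tendsto ε atTop (𝓝[≠] 0))
    (hroot : ∀ (n : ℕ) (a b : ℝ) (t : ℂ), (a ≠ 0 ∨ b ≠ 0) →
      MvPolynomial.eval₂ (algebraMap ℝ ℂ) ![(a : ℂ) + t, -(a : ℂ) + t, (b : ℂ)]
        ((MvPolynomial.X 0 ^ 2 + MvPolynomial.X 1 ^ 2 + MvPolynomial.X 2 ^ 2) ^ m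
          + MvPolynomial.C (ε n) * Q) = 0 → t.re = 0)
    (v : Fin 2 → ℝ) (hv : v ≠ 0) :
    MvPolynomial.aeval
      (Fin.cons (Complex.I * Real.sqrt (v 0 ^ 2 + 2 * v 1 ^ 2)) (fun j => (v j : ℂ)) :
        Fin 3 → ℂ)
      (MvPolynomial.C ((2 : ℝ) ^ m) * MvPolynomial.aeval
        ![MvPolynomial.C (1 / 2 : ℝ) * (X 0 + X 1), MvPolynomial.C (1 / 2 : ℝ) * (X 0 - X 1),
          (X 2 : MvPolynomial (Fin 3) ℝ)] Q) = 0 := by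
  apply aeval_nullPoint_eq_zero hm _ (rotated_isHomogeneous hhom _).totalDegree_le
    (rotated_even hsymm heven _) ε hε v
  intro n y hy
  have hab : v 0 / 2 ≠ 0 ∨ v 1 ≠ 0 := by
    by_contra h
    push Not at h
    apply hv
    funext j
    fin_cases j
    · simpa using h.1
    · simpa using h.2
  have hT := rootTest_transfer (m := m) Q (ε n) (v 0 / 2) (v 1)
    (fun t ht => hroot n _ _ t hab ht) y
  have hv' : (fun j => (((![2 * (v 0 / 2), v 1] : Fin 2 → ℝ) j : ℝ) : ℂ)) = fun j => (v j : ℂ) := by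
    funext j
    fin_cases j
    · simp
      ring
    · simp
  rw [hv'] at hT
  exact hT hy

/-- **Induction step (`m + 1 ≥ 3`).** `Q = (x·x) · M` with `M` satisfying all hypotheses for
`m`. -/
theorem NullConeLocalRigidity.step {m : ℕ} (hm : 2 ≤ m)
    (Q : MvPolynomial (Fin 3) ℝ) (hhom : Q.IsHomogeneous (2 * (m + 1)))
    (hsymm : ∀ σ : Equiv.Perm (Fin 3), rename σ Q = Q)
    (heven : ∀ i : Fin 3, MvPolynomial.aeval
      (fun j : Fin 3 => if j = i then -(X j : MvPolynomial (Fin 3) ℝ) else X j) Q = Q)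
    (ε : ℕ → ℝ) (hε : Tendsto ε atTop (𝓝[≠] 0))
    (hroot : ∀ (n : ℕ) (a b : ℝ) (t : ℂ), (a ≠ 0 ∨ b ≠ 0) →
      MvPolynomial.eval₂ (algebraMap ℝ ℂ) ![(a : ℂ) + t, -(a : ℂ) + t, (b : ℂ)]
        ((MvPolynomial.X 0 ^ 2 + MvPolynomial.X 1 ^ 2 + MvPolynomial.X 2 ^ 2) ^ (m + 1)
          + MvPolynomial.C (ε n) * Q) = 0 → t.re = 0) :
    ∃ M : MvPolynomial (Fin 3) ℝ,
      Q = ((X 0 : MvPolynomial (Fin 3) ℝ) ^ 2 + X 1 ^ 2 + X 2 ^ 2) * M ∧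
      M.IsHomogeneous (2 * m) ∧ (∀ σ : Equiv.Perm (Fin 3), rename σ M = M) ∧
      (∀ i : Fin 3, MvPolynomial.aeval
        (fun j : Fin 3 => if j = i then -(X j : MvPolynomial (Fin 3) ℝ) else X j) M = M) ∧
      (∀ (n : ℕ) (a b : ℝ) (t : ℂ), (a ≠ 0 ∨ b ≠ 0) →
        MvPolynomial.eval₂ (algebraMap ℝ ℂ) ![(a : ℂ) + t, -(a : ℂ) + t, (b : ℂ)]
          ((MvPolynomial.X 0 ^ 2 + MvPolynomial.X 1 ^ 2 + MvPolynomial.X 2 ^ 2) ^ m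
            + MvPolynomial.C (ε n) * M) = 0 → t.re = 0) := by
  have hnull := rotated_null_eq_zero (m := m + 1) (by omega) Q hhom hsymm heven ε hε hroot
  have hdvd := sumSq_dvd_of_rotated_dvd (m := m + 1) Q (quad_dvd_of_aeval_null_eq_zero _ hnull)
  obtain ⟨M₀, hM₀⟩ := hdvd
  set M := homogeneousComponent (2 * m) M₀ with hM
  have hQM : Q = ((X 0 : MvPolynomial (Fin 3) ℝ) ^ 2 + X 1 ^ 2 + X 2 ^ 2) * M :=
    eq_mul_homogeneousComponent (k := 2) (n := 2 * m) sumSq_isHomogeneous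
      (by rw [show 2 + 2 * m = 2 * (m + 1) by ring]; exact hhom) hM₀
  refine ⟨M, hQM, homogeneousComponent_isHomogeneous _ _, ?_, ?_, ?_⟩
  · intro σ
    have h := hsymm σ
    rw [hQM, map_mul, rename_sumSq] at h
    exact mul_left_cancel₀ sumSq_ne_zero h
  · intro i
    have h := heven i
    rw [hQM, map_mul, aeval_neg_sumSq] at h
    exact mul_left_cancel₀ sumSq_ne_zero h
  · intro n a b t hab ht
    apply hroot n a b t hab
    rw [hQM, show ∀ (P M : MvPolynomial (Fin 3) ℝ) (e : ℝ),
      P ^ (m + 1) + MvPolynomial.C e * (P * M) = P * (P ^ m + MvPolynomial.C e * M) from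
        fun P M e => by ring, MvPolynomial.eval₂_mul, ht, mul_zero]

/-! ### The level `m = 2` -/

/-- Powers of the two special Gaussian numbers. -/
theorem NullConeLocalRigidity.gaussian_pows :
    (1 + Complex.I) ^ 4 = -4 ∧ (-1 + Complex.I) ^ 4 = -4 ∧
    (1 + Complex.I) ^ 2 * (-1 + Complex.I) ^ 2 = 4 ∧
    (1 + 3 * Complex.I) ^ 4 = 28 - 96 * Complex.I ∧ (-1 + 3 * Complex.I) ^ 4 = 28 + 96 * Complex.I ∧
    (1 + 3 * Complex.I) ^ 2 * (-1 + 3 * Complex.I) ^ 2 = 100 := by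
  refine ⟨?_, ?_, ?_, ?_, ?_, ?_⟩ <;>
  · apply Complex.ext <;> simp [pow_succ] <;> norm_num

/-- Values of the two basic quartics at the null vectors `(1+i, -1+i, 0)`, `(1+3i, -1+3i, 4)`. -/
theorem NullConeLocalRigidity.quartic_values (A B : ℝ) :
    MvPolynomial.aeval ![1 + Complex.I, -1 + Complex.I, 0]
        (MvPolynomial.C A * ((X 0 : MvPolynomial (Fin 3) ℝ) ^ 4 + X 1 ^ 4 + X 2 ^ 4)
          + MvPolynomial.C B * ((X 0 : MvPolynomial (Fin 3) ℝ) ^ 2 * X 1 ^ 2 + X 0 ^ 2 * X 2 ^ 2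
              + X 1 ^ 2 * X 2 ^ 2)) = ((-8 * A + 4 * B : ℝ) : ℂ) ∧
      MvPolynomial.aeval ![1 + 3 * Complex.I, -1 + 3 * Complex.I, 4]
        (MvPolynomial.C A * ((X 0 : MvPolynomial (Fin 3) ℝ) ^ 4 + X 1 ^ 4 + X 2 ^ 4)
          + MvPolynomial.C B * ((X 0 : MvPolynomial (Fin 3) ℝ) ^ 2 * X 1 ^ 2 + X 0 ^ 2 * X 2 ^ 2
              + X 1 ^ 2 * X 2 ^ 2)) = ((312 * A - 156 * B : ℝ) : ℂ) := by
  obtain ⟨g1, g2, g3, g4, g5, g6⟩ := gaussian_pows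
  constructor
  · simp only [map_add, map_mul, map_pow, MvPolynomial.aeval_C, MvPolynomial.aeval_X,
      Matrix.cons_val_zero, Matrix.cons_val_one, Matrix.cons_val_two, Matrix.head_cons,
      Matrix.tail_cons, Complex.coe_algebraMap, g1, g2, g3]
    push_cast
    ring
  · have g7 : (1 + 3 * Complex.I) ^ 2 * (4 : ℂ) ^ 2 + (-1 + 3 * Complex.I) ^ 2 * 4 ^ 2 = -256 := by
      apply Complex.ext <;> simp [pow_succ] <;> norm_num
    simp only [map_add, map_mul, map_pow, MvPolynomial.aeval_C, MvPolynomial.aeval_X,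
      Matrix.cons_val_zero, Matrix.cons_val_one, Matrix.cons_val_two, Matrix.head_cons,
      Matrix.tail_cons, Complex.coe_algebraMap, g4, g5]
    push_cast
    linear_combination (B : ℂ) * (g6 + g7)

/-- A real number `w` with `εₙ w ≤ O(εₙ²)` and `-39 εₙ w ≤ O(εₙ²)` along `εₙ → 0`, `εₙ ≠ 0`,
vanishes. -/
theorem NullConeLocalRigidity.eq_zero_of_two_sided (ε : ℕ → ℝ) (hε : Tendsto ε atTop (𝓝[≠] 0))
    (w K₁ K₂ : ℝ) (h1 : ∀ᶠ n in atTop, ε n * w ≤ K₁ * ε n ^ 2)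
    (h2 : ∀ᶠ n in atTop, ε n * (-39 * w) ≤ K₂ * ε n ^ 2) : w = 0 := by
  by_contra hw
  obtain ⟨hε0, hne⟩ := tendsto_nhdsWithin_iff.1 hε
  set K := |K₁| + |K₂| with hK
  have h3 : ∀ᶠ n in atTop, K * |ε n| < |w| := by
    have : Tendsto (fun n => K * |ε n|) atTop (𝓝 0) := by
      simpa using hε0.abs.const_mul K
    exact this.eventually_lt_const (abs_pos.2 hw)
  obtain ⟨n, hn0, hn1, hn2, hn3⟩ := (hne.and (h1.and (h2.and h3))).exists
  have hn0' : ε n ≠ 0 := hn0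
  have hsq : 0 ≤ ε n ^ 2 := sq_nonneg _
  have hK1 : K₁ * ε n ^ 2 ≤ |K₁| * ε n ^ 2 := mul_le_mul_of_nonneg_right (le_abs_self K₁) hsq
  have hK2 : K₂ * ε n ^ 2 ≤ |K₂| * ε n ^ 2 := mul_le_mul_of_nonneg_right (le_abs_self K₂) hsq
  have hup : ε n * w ≤ K * ε n ^ 2 := by
    rw [hK]
    nlinarith [abs_nonneg K₂]
  have hlow : -(K * ε n ^ 2) ≤ ε n * w := by
    rw [hK]
    nlinarith [abs_nonneg K₁]
  have habs : |ε n| * |w| ≤ K * |ε n| * |ε n| := by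
    rw [← abs_mul, mul_assoc, ← sq, sq_abs]
    exact abs_le.2 ⟨by linarith, hup⟩
  have hpos : 0 < |ε n| := abs_pos.2 hn0'
  have : |w| ≤ K * |ε n| := by
    have h := habs
    rw [mul_comm (|ε n|) (|w|), mul_assoc, mul_comm] at h
    nlinarith
  linarith

/-- **Base level `m = 2`.** -/
theorem NullConeLocalRigidity.base_two (Q : MvPolynomial (Fin 3) ℝ) (hhom : Q.IsHomogeneous 4)
    (hsymm : ∀ σ : Equiv.Perm (Fin 3), rename σ Q = Q)
    (heven : ∀ i : Fin 3, MvPolynomial.aeval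
      (fun j : Fin 3 => if j = i then -(X j : MvPolynomial (Fin 3) ℝ) else X j) Q = Q)
    (ε : ℕ → ℝ) (hε : Tendsto ε atTop (𝓝[≠] 0))
    (hroot : ∀ (n : ℕ) (a b : ℝ) (t : ℂ), (a ≠ 0 ∨ b ≠ 0) →
      MvPolynomial.eval₂ (algebraMap ℝ ℂ) ![(a : ℂ) + t, -(a : ℂ) + t, (b : ℂ)]
        ((MvPolynomial.X 0 ^ 2 + MvPolynomial.X 1 ^ 2 + MvPolynomial.X 2 ^ 2) ^ 2
          + MvPolynomial.C (ε n) * Q) = 0 → t.re = 0) :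
    ∃ c : ℝ, Q = MvPolynomial.C c * ((X 0 : MvPolynomial (Fin 3) ℝ) ^ 2 + X 1 ^ 2 + X 2 ^ 2) ^ 2 := by
  have hQ := quartic_eq Q hhom hsymm heven
  set A := coeff (Finsupp.single 0 4) Q with hA
  set B := coeff (Finsupp.single 0 2 + Finsupp.single 1 2) Q with hB
  set Q'' := MvPolynomial.C ((2 : ℝ) ^ 2) * MvPolynomial.aeval
    ![MvPolynomial.C (1 / 2 : ℝ) * (X 0 + X 1), MvPolynomial.C (1 / 2 : ℝ) * (X 0 - X 1),
      (X 2 : MvPolynomial (Fin 3) ℝ)] Q with hQ''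
  have hdeg : Q''.totalDegree ≤ 2 * 2 := (rotated_isHomogeneous hhom _).totalDegree_le
  have hev : ∀ d : Fin 3 →₀ ℕ, Odd (d 0) → coeff d Q'' = 0 := rotated_even hsymm heven _
  obtain ⟨v1, v2⟩ := quartic_values A B
  -- the fibre through (a, b) = (1, 0): null vector (1+i, -1+i, 0)
  obtain ⟨w₁, K₁, hw₁, hev₁⟩ := eventually_mul_nullValue_le Q'' hdeg hev ε hε ![2 * 1, 0]
    (fun n => rootTest_transfer (m := 2) Q (ε n) 1 0 (fun t ht => hroot n 1 0 t (by simp) ht))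
  have hval₁ : (w₁ : ℂ) = (2 : ℂ) ^ 2 * ((-8 * A + 4 * B : ℝ) : ℂ) := by
    have hs : Real.sqrt (((![2 * 1, 0] : Fin 2 → ℝ) 0) ^ 2 + 2 * ((![2 * 1, 0] : Fin 2 → ℝ) 1) ^ 2)
        = 2 := by
      rw [show ((![2 * 1, 0] : Fin 2 → ℝ) 0) ^ 2 + 2 * ((![2 * 1, 0] : Fin 2 → ℝ) 1) ^ 2
        = (2 : ℝ) ^ 2 by norm_num, Real.sqrt_sq (by norm_num)]
    rw [← hw₁, hQ'', aeval_cons_rotated _ _ _ Q ![1 + Complex.I, -1 + Complex.I, 0]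
      (by rw [hs]; simp only [Matrix.cons_val_zero]; push_cast; ring)
      (by rw [hs]; simp only [Matrix.cons_val_zero, Matrix.cons_val_one]; push_cast; ring)
      (by simp), ← v1, hQ]
    norm_num
  -- the fibre through (a, b) = (1, 4): null vector (1+3i, -1+3i, 4)
  obtain ⟨w₂, K₂, hw₂, hev₂⟩ := eventually_mul_nullValue_le Q'' hdeg hev ε hε ![2 * 1, 4]
    (fun n => rootTest_transfer (m := 2) Q (ε n) 1 4 (fun t ht => hroot n 1 4 t (by simp) ht))
  have hval₂ : (w₂ : ℂ) = (2 : ℂ) ^ 2 * ((312 * A - 156 * B : ℝ) : ℂ) := by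
    have hs : Real.sqrt (((![2 * 1, 4] : Fin 2 → ℝ) 0) ^ 2 + 2 * ((![2 * 1, 4] : Fin 2 → ℝ) 1) ^ 2)
        = 6 := by
      rw [show ((![2 * 1, 4] : Fin 2 → ℝ) 0) ^ 2 + 2 * ((![2 * 1, 4] : Fin 2 → ℝ) 1) ^ 2
        = (6 : ℝ) ^ 2 by norm_num, Real.sqrt_sq (by norm_num)]
    rw [← hw₂, hQ'', aeval_cons_rotated _ _ _ Q ![1 + 3 * Complex.I, -1 + 3 * Complex.I, 4]
      (by rw [hs]; simp only [Matrix.cons_val_zero]; push_cast; ring)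
      (by rw [hs]; simp only [Matrix.cons_val_zero, Matrix.cons_val_one]; push_cast; ring)
      (by simp), ← v2, hQ]
    norm_num
  have hw₁' : w₁ = 4 * (-8 * A + 4 * B) := by exact_mod_cast hval₁
  have hw₂' : w₂ = -39 * w₁ := by
    have : w₂ = 4 * (312 * A - 156 * B) := by exact_mod_cast hval₂
    rw [this, hw₁']
    ring
  rw [hw₂'] at hev₂
  have hw0 := eq_zero_of_two_sided ε hε w₁ K₁ K₂ hev₁ hev₂
  have hBA : B = 2 * A := by
    rw [hw₁'] at hw0
    linarith
  refine ⟨A, ?_⟩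
  rw [hQ, hBA, map_mul, map_ofNat]
  ring

/-! ### The induction and the theorem -/

/-- **Null-cone local rigidity, all levels** (induction on `m`). -/
theorem NullConeLocalRigidity.main (m : ℕ) :
    ∀ Q : MvPolynomial (Fin 3) ℝ, Q.IsHomogeneous (2 * m) →
      (∀ σ : Equiv.Perm (Fin 3), MvPolynomial.rename σ Q = Q) →
      (∀ i : Fin 3, MvPolynomial.aeval
        (fun j : Fin 3 => if j = i then -(MvPolynomial.X j) else MvPolynomial.X j) Q = Q) →
      (∃ ε : ℕ → ℝ, Filter.Tendsto ε Filter.atTop (𝓝[≠] (0 : ℝ)) ∧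
        ∀ (n : ℕ) (a b : ℝ) (t : ℂ), (a ≠ 0 ∨ b ≠ 0) →
          MvPolynomial.eval₂ (algebraMap ℝ ℂ) ![(a : ℂ) + t, -(a : ℂ) + t, (b : ℂ)]
            ((MvPolynomial.X 0 ^ 2 + MvPolynomial.X 1 ^ 2 + MvPolynomial.X 2 ^ 2) ^ m
              + MvPolynomial.C (ε n) * Q) = 0 → t.re = 0) →
      ∃ c : ℝ, Q = MvPolynomial.C c
        * (MvPolynomial.X 0 ^ 2 + MvPolynomial.X 1 ^ 2 + MvPolynomial.X 2 ^ 2) ^ m := by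
  induction m with
  | zero =>
    intro Q hhom _ _ _
    refine ⟨coeff 0 Q, ?_⟩
    rw [pow_zero, mul_one]
    exact totalDegree_eq_zero_iff_eq_C.1 (Nat.le_zero.1 hhom.totalDegree_le)
  | succ m IH =>
    intro Q hhom hsymm heven hyp
    obtain ⟨ε, hε, hroot⟩ := hyp
    rcases Nat.lt_or_ge m 2 with hm | hm
    · interval_cases m
      · exact ⟨_, by rw [pow_one]; exact quadratic_eq Q hhom hsymm heven⟩
      · exact base_two Q hhom hsymm heven ε hε hroot
    · obtain ⟨M, hQM, hMhom, hMsymm, hMeven, hMroot⟩ := step hm Q hhom hsymm heven ε hε hroot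
      obtain ⟨c, hc⟩ := IH M hMhom hMsymm hMeven ⟨ε, hε, hMroot⟩
      exact ⟨c, by rw [hQM, hc]; ring⟩

/-- **Item `stmt-CriticalPhenomena-4275` (`NullConeLocalRigidity`), proved.** An `O_h`-invariant
real form `Q` of degree `2m` whose pencil `(k·k)^m + εₙ Q` passes the root test of reflection
positivity in the diagonal mirror `x₀ = x₁` along a real sequence `εₙ → 0`, `εₙ ≠ 0`, is
`c · (k·k)^m`. -/
theorem nullConeLocalRigidity_proof :
    Summit.CriticalPhenomena.Ising3DConformalLimit.Theses.HyperoctahedralRP.NullConeLocalRigidity := by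
  unfold Summit.CriticalPhenomena.Ising3DConformalLimit.Theses.HyperoctahedralRP.NullConeLocalRigidity
  intro m Q hhom hsymm heven hyp
  exact NullConeLocalRigidity.main m Q hhom hsymm heven hyp

end Summit.CriticalPhenomena.Ising3DConformalLimit.Theorems

end
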